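import Summits.ValiantsHypothesis.ValiantsHypothesis.Theorems.MonotoneRestorationOrbitRestorationQPWaringSylvester
import Summits.ValiantsHypothesis.ValiantsHypothesis.Theorems.MonotoneRestorationOrbitRestorationQPWaringIdentifiable
import HarnessLib

/-!
# A_∞ on the Sylvester stratum of ΣΛΣ: few powers of high degree, no independence

Route MonotoneRestoration, crux `OrbitRestorationQP` (stmt-ValiantsHypothesis-18293), line `depth-three-rung`,
stub A_∞ `stub_sigmaPiSigmaValue`.  Namespace `Summit.ValiantsHypothesis.ValiantsHypothesis.Theorems.WaringJennrich`.

Second identifiable regime of ΣΛΣ (after Jennrich's, `…WaringJennrich*.lean`): by Sylvester's independence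
(`linearIndependent_pow_of_nonproportional`, `…WaringSylvester.lean`) a Waring expression
`f = Σ_{i<r} a_i ℓ_{w_i}^d` with PAIRWISE NON-PROPORTIONAL forms and `2r ≤ d + 1` is unique among such
expressions — the forms may be linearly dependent and `r` may exceed the number `n²` of variables.

* `sylvester_terms` — **uniqueness**: if `Σ_{i<r} a_i ℓ_{w_i}^d = Σ_{j<r} a'_j ℓ_{v_j}^d` with both families
  nonzero and pairwise non-proportional, all coefficients nonzero and `2r ≤ d + 1`, then every `v_j` is
  `c_j w_{k_j}` with `a'_j c_j^d = a_{k_j}` (group the `2r` powers into proportionality classes; the unmatched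
  ones together with the `ℓ_{w_i}^d` are independent);
* `identifiable_of_nonproportional` — hence such an `f` is identifiable along the diagonal group, and
* `qpOrbitRestorable_of_nonproportionalWaring`, `sigmaLambdaSigma_sylvester_restoration` — **every
  matrix-symmetric family that is, at each level, a sum of `r ≤ n^c₀+c₀` nonzero multiples of `d`-th powers
  of pairwise non-proportional linear forms with `2r ≤ d + 1 ≤ n^c₀+c₀+1` is quasi-polynomially
  orbit-restorable** (plug-in `qpOrbitRestorable_of_identifiableWaring`).

Honest label: sub-rung of A_∞ (identifiable ΣΛΣ, Sylvester regime); A_∞ and the crux stay open; VP ≠ VNP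
untouched. [folklore; Sylvester 1851]
-/

noncomputable section

open scoped Classical

-- `Summit.ValiantsHypothesis.ValiantsHypothesis.…` is the tree's single-conjunct layout (Sub = Summit).
set_option linter.dupNamespace false

namespace Summit.ValiantsHypothesis.ValiantsHypothesis.Theorems

namespace WaringJennrich

open MvPolynomial Finset OrbitRestorationQPDepthThreeRung

universe u v

section General

variable {K : Type u} [Field K] [CharZero K] [Infinite K] {X : Type v} [Fintype X]

/-- **Sylvester uniqueness of low-rank, high-degree Waring decompositions.**  If
`Σ_{i<r} a_i ℓ_{w_i}^d = Σ_{j<r} a'_j ℓ_{v_j}^d` where both `w` and `v` are families of nonzero, pairwise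
non-proportional coefficient vectors, all `a'_j ≠ 0` and `2r ≤ d + 1`, then every `v_j` is a multiple
`c_j w_{k_j}` with `a'_j c_j^d = a_{k_j}` (so the `a_i` are nonzero too). [folklore; Sylvester] -/
theorem sylvester_terms {r d : ℕ} (w v : Fin r → X → K) (a a' : Fin r → K)
    (hw0 : ∀ i, w i ≠ 0) (hnp : ∀ i i', i ≠ i' → ∀ c : K, w i ≠ c • w i')
    (hv0 : ∀ j, v j ≠ 0) (hnp' : ∀ j j', j ≠ j' → ∀ c : K, v j ≠ c • v j')
    (ha' : ∀ j, a' j ≠ 0) (hr : 2 * r ≤ d + 1)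
    (h : ∑ i, C (a i) * lin (w i) ^ d = ∑ j, C (a' j) * lin (v j) ^ d) (j : Fin r) :
    ∃ (k : Fin r) (c : K), v j = c • w k ∧ a' j * c ^ d = a k := by
  -- matched indices and their witnesses
  let M : Fin r → Prop := fun j => ∃ (i : Fin r) (c : K), v j = c • w i
  have hchoice : ∀ j, ∃ p : Fin r × K, M j → v j = p.2 • w p.1 := by
    intro j
    by_cases hj : M j
    · obtain ⟨i, c, hc⟩ := hj; exact ⟨(i, c), fun _ => hc⟩
    · exact ⟨(j, 0), fun h' => (hj h').elim⟩
  choose p hp using hchoice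
  set κ : Fin r → Fin r := fun j => (p j).1 with hκ
  set c : Fin r → K := fun j => (p j).2 with hc
  have hmatch : ∀ j, M j → v j = c j • w (κ j) := fun j hj => hp j hj
  -- the combined family: all `w_i` and the unmatched `v_j`
  let Q : Fin r ⊕ {j // ¬ M j} → X → K := Sum.elim w fun j => v j.1
  have hQ0 : ∀ t, Q t ≠ 0 := by
    rintro (i | ⟨j, hj⟩)
    · exact hw0 i
    · exact hv0 j
  have hQnp : ∀ t t', t ≠ t' → ∀ e : K, Q t ≠ e • Q t' := by
    rintro (i | ⟨j, hj⟩) (i' | ⟨j', hj'⟩) hne e hQ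
    · exact hnp i i' (fun h' => hne (by rw [h'])) e hQ
    · -- `w i = e • v j'` would match `j'`
      change w i = e • v j' at hQ
      have he : e ≠ 0 := fun h0 => hw0 i (by rw [hQ, h0, zero_smul])
      exact hj' ⟨i, e⁻¹, by rw [hQ, smul_smul, inv_mul_cancel₀ he, one_smul]⟩
    · change v j = e • w i' at hQ
      exact hj ⟨i', e, hQ⟩
    · have hjj' : j ≠ j' := fun h' => hne (by subst h'; rfl)
      exact hnp' j j' hjj' e hQ
  have hcard : Fintype.card (Fin r ⊕ {j // ¬ M j}) ≤ d + 1 := by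
    rw [Fintype.card_sum, Fintype.card_fin]
    have := Fintype.card_subtype_le fun j : Fin r => ¬ M j
    rw [Fintype.card_fin] at this
    omega
  have hind := linearIndependent_pow_of_nonproportional' (d := d) Q hcard hQ0 hQnp
  rw [Fintype.linearIndependent_iff] at hind
  -- coefficients of the vanishing combination
  let F : Fin r → Finset (Fin r) := fun i => (univ.filter M).filter fun j => κ j = i
  let G : Fin r ⊕ {j // ¬ M j} → K :=
    Sum.elim (fun i => a i - ∑ j ∈ F i, a' j * c j ^ d) fun j => -a' j.1
  -- matched terms are multiples of powers of the `w`
  have hmt : ∀ j, M j → C (a' j) * lin (v j) ^ d = C (a' j * c j ^ d) * lin (w (κ j)) ^ d := by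
    intro j hj
    rw [hmatch j hj, lin_smul, mul_pow, ← map_pow, ← mul_assoc, ← map_mul]
  have hsumM : ∑ j ∈ univ.filter M, C (a' j) * lin (v j) ^ d =
      ∑ i, C (∑ j ∈ F i, a' j * c j ^ d) * lin (w i) ^ d := by
    rw [Finset.sum_congr rfl fun j hj => hmt j (Finset.mem_filter.1 hj).2]
    rw [← Finset.sum_fiberwise (univ.filter M) κ fun j => C (a' j * c j ^ d) * lin (w (κ j)) ^ d]
    refine Finset.sum_congr rfl fun i _ => ?_
    rw [map_sum, Finset.sum_mul]
    refine Finset.sum_congr rfl fun j hj => ?_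
    rw [(Finset.mem_filter.1 hj).2]
  have hsumN : ∑ j ∈ univ.filter (fun j => ¬ M j), C (a' j) * lin (v j) ^ d =
      ∑ j : {j // ¬ M j}, C (a' j.1) * lin (v j.1) ^ d :=
    Finset.sum_subtype _ (fun j => by simp) fun j => C (a' j) * lin (v j) ^ d
  have hrel : ∑ t, G t • lin (Q t) ^ d = 0 := by
    rw [Fintype.sum_sum_type]
    simp only [G, Q, Sum.elim_inl, Sum.elim_inr, smul_eq_C_mul, map_sub, map_neg, sub_mul, neg_mul,
      Finset.sum_sub_distrib, Finset.sum_neg_distrib]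
    rw [h, ← Finset.sum_filter_add_sum_filter_not univ M, hsumM, hsumN]
    ring
  have hG := hind G hrel
  -- every `j` is matched
  have hM : ∀ j, M j := by
    intro j
    by_contra hj
    have := hG (Sum.inr ⟨j, hj⟩)
    simp only [G, Sum.elim_inr, neg_eq_zero] at this
    exact ha' j this
  -- the matching is injective
  have hc0 : ∀ j, c j ≠ 0 := fun j h0 => hv0 j (by rw [hmatch j (hM j), h0, zero_smul])
  have hinj : Function.Injective κ := by
    intro j j' hjj'
    by_contra hne
    refine hnp' j' j (Ne.symm hne) (c j' / c j) ?_
    rw [hmatch j (hM j), hmatch j' (hM j'), hjj', smul_smul, div_mul_cancel₀ _ (hc0 j)]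
  -- the fibre over `κ j` is `{j}`
  have hF : F (κ j) = {j} := by
    ext j'
    simp only [F, Finset.mem_filter, Finset.mem_univ, true_and, Finset.mem_singleton]
    exact ⟨fun h' => hinj h'.2, fun h' => by subst h'; exact ⟨hM _, rfl⟩⟩
  have hi := hG (Sum.inl (κ j))
  simp only [G, Sum.elim_inl, hF, Finset.sum_singleton, sub_eq_zero] at hi
  exact ⟨κ j, c j, hmatch j (hM j), hi.symm⟩

end General

/-! ### The diagonal action and restorability -/

variable {n : ℕ}

/-- Permuting coordinates preserves pairwise non-proportionality. [folklore] -/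
theorem nonproportional_perm {r : ℕ} (σ : Equiv.Perm (Fin n)) {w : Fin r → (Fin n × Fin n) → ℂ}
    (hnp : ∀ i i', i ≠ i' → ∀ c : ℂ, w i ≠ c • w i') :
    ∀ i i', i ≠ i' → ∀ c : ℂ, (fun x => w i (σ⁻¹ • x)) ≠ c • fun x => w i' (σ⁻¹ • x) := by
  intro i i' hii' c h
  refine hnp i i' hii' c (funext fun x => ?_)
  have := congrFun h (σ • x)
  simp only [Pi.smul_apply, inv_smul_smul] at this
  exact this

/-- Permuting coordinates preserves being nonzero. [folklore] -/
theorem ne_zero_perm {r : ℕ} (σ : Equiv.Perm (Fin n)) {w : Fin r → (Fin n × Fin n) → ℂ}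
    (hw0 : ∀ i, w i ≠ 0) (i : Fin r) : (fun x => w i (σ⁻¹ • x)) ≠ 0 := by
  intro h
  refine hw0 i (funext fun x => ?_)
  have := congrFun h (σ • x)
  simp only [inv_smul_smul, Pi.zero_apply] at this
  exact this

/-- **The Sylvester stratum is identifiable along the group.** [folklore] -/
theorem identifiable_of_nonproportional {r d : ℕ} (w : Fin r → (Fin n × Fin n) → ℂ) (a : Fin r → ℂ)
    (hw0 : ∀ i, w i ≠ 0) (hnp : ∀ i i', i ≠ i' → ∀ c : ℂ, w i ≠ c • w i') (ha : ∀ i, a i ≠ 0)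
    (hr : 2 * r ≤ d + 1) (σ : Equiv.Perm (Fin n))
    (h : ∑ i, C (a i) * (lin (w i) + C ((fun _ => (0 : ℂ)) i)) ^ d =
      ∑ j, C (a j) * (lin (fun x => w j (σ⁻¹ • x)) + C ((fun _ => (0 : ℂ)) j)) ^ d) (j : Fin r) :
    ∃ (k : Fin r) (c : ℂ), lin (fun x => w j (σ⁻¹ • x)) + C ((fun _ => (0 : ℂ)) j) =
      C c * (lin (w k) + C ((fun _ => (0 : ℂ)) k)) ∧ a j * c ^ d = a k := by
  simp only [map_zero, add_zero] at h ⊢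
  obtain ⟨k, c, hkc, hcoef⟩ := sylvester_terms w (fun j => fun x => w j (σ⁻¹ • x)) a a hw0 hnp
    (ne_zero_perm σ hw0) (nonproportional_perm σ hnp) ha hr h j
  exact ⟨k, c, by rw [hkc, lin_smul], hcoef⟩

/-- **A_∞ on the Sylvester stratum, one level**: a diagonally `Sym(Fin n)`-invariant
`f = Σ_{i<r} a_i ℓ_{w_i}^d` with nonzero pairwise non-proportional `w`, nonzero `a_i`, `2r ≤ d + 1` and
`r·d ≤ 2^((log₂ n + c)^c)` is `QPOrbitRestorable (c+5) n f`. [folklore] -/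
theorem qpOrbitRestorable_of_nonproportionalWaring {c r d : ℕ} (w : Fin r → (Fin n × Fin n) → ℂ)
    (a : Fin r → ℂ) (hw0 : ∀ i, w i ≠ 0) (hnp : ∀ i i', i ≠ i' → ∀ c : ℂ, w i ≠ c • w i')
    (ha : ∀ i, a i ≠ 0) (hr : 2 * r ≤ d + 1) (hd : 1 ≤ d) (hB : r * d ≤ 2 ^ ((Nat.log 2 n + c) ^ c))
    {f : MvPolynomial (Fin n × Fin n) ℂ} (hf : f = ∑ i, C (a i) * lin (w i) ^ d)
    (hfix : ∀ σ : Equiv.Perm (Fin n), ren σ f = f) : QPOrbitRestorable (c + 5) n f := by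
  have hf' : f = ∑ i, C (a i) * (lin (w i) + C ((fun _ => (0 : ℂ)) i)) ^ d := by
    simp only [map_zero, add_zero]; exact hf
  exact qpOrbitRestorable_of_identifiableWaring w (fun _ => 0) a hd ha
    (identifiable_of_nonproportional w a hw0 hnp ha hr) hB hf' hfix

/-- **A_∞ ON THE SYLVESTER STRATUM OF ΣΛΣ (family form).**  Every matrix-symmetric family `f` which at every
level `n` is a sum of `r ≤ n^c₀ + c₀` nonzero multiples of `d`-th powers, `2r ≤ d + 1`, `1 ≤ d ≤ n^c₀ + c₀`, of
nonzero PAIRWISE NON-PROPORTIONAL linear forms (no linear independence; `r` may exceed `n²`) is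
quasi-polynomially orbit-restorable — a second unbounded-top-fan-in instance of `stub_sigmaPiSigmaValue`
(A_∞) of line `depth-three-rung`. [folklore] -/
theorem sigmaLambdaSigma_sylvester_restoration (f : (n : ℕ) → MvPolynomial (Fin n × Fin n) ℂ)
    (hsym : IsMatrixSymmetric f)
    (h : ∃ c₀ : ℕ, ∀ n : ℕ, ∃ (r d : ℕ) (w : Fin r → (Fin n × Fin n) → ℂ) (a : Fin r → ℂ),
      1 ≤ d ∧ 2 * r ≤ d + 1 ∧ r ≤ n ^ c₀ + c₀ ∧ d ≤ n ^ c₀ + c₀ ∧ (∀ i, w i ≠ 0) ∧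
        (∀ i i', i ≠ i' → ∀ c : ℂ, w i ≠ c • w i') ∧ (∀ i, a i ≠ 0) ∧
          f n = ∑ i, C (a i) * lin (w i) ^ d) :
    ∃ c : ℕ, ∀ n : ℕ, QPOrbitRestorable c n (f n) := by
  obtain ⟨c₀, hc₀⟩ := h
  obtain ⟨c, hc⟩ := sq_polyBound_le_qp c₀
  refine ⟨c + 5, fun n => ?_⟩
  obtain ⟨r, d, w, a, hd, hr, hrle, hdle, hw0, hnp, ha, hf⟩ := hc₀ n
  refine qpOrbitRestorable_of_nonproportionalWaring w a hw0 hnp ha hr hd ?_ hf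
    (ValueOrbit.ren_eq_of_matrixSymmetric (hsym n))
  exact (Nat.mul_le_mul hrle hdle).trans (hc n)

end WaringJennrich

end Summit.ValiantsHypothesis.ValiantsHypothesis.Theorems

end
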